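import Literature.Topology.FourManifolds.OneHandlebodyBoundaryFundamentalGroup
import HarnessLib

/-!
# A regular sublevel set of a `1`-handlebody below its top critical point is a connected
# `1`-handlebody, and `π₁` of its boundary level maps onto its `π₁`

Topic `Literature/Topology/FourManifolds` (fact seat
`provefact-Literature.Topology.FourManifolds.lauden-f709dd520c`, Laudenbach–Poénaru's Lemma 2, the
slide `H₃`: the foot of the top `1`-handle is pushed around a loop of the level `f⁻¹(a)` below
the handle representing a prescribed element of `π₁` of the sublevel set `{f ≤ a}`, which
exists because `π₁(f⁻¹(a)) → π₁({f ≤ a})` is onto).  Everything here is **proved**; no named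
facts.

* `isPreconnected_univ_of_isStrongDeformationRetractOf` — a space strong deformation retracting
  onto a preconnected subset is preconnected;
* `IsMorseAdapted.connectedSpace_of_counts` — a compact manifold with boundary carrying an
  adapted Morse function with one critical point of index `0` and none of index `≥ 2` is
  connected (it deformation retracts onto a ball with arcs attached,
  `IsMorseAdapted.exists_ball_union_arcs_isStrongDeformationRetractOf`);
* `IsMorseAdapted.sublevel_counts` — for a level `a < 1` through no critical point, above the
  value of the critical point of index `0`, the sublevel set `{f ≤ a}` (structure
  `sublevelAtlas`, adapted Morse function `f| + (1 - a)`, Milnor's Lemma 2.9 /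
  `sublevel_morseData`) again has one critical point of index `0` and none of index `≥ 2`; hence
  it is connected and
* `IsMorseAdapted.surjective_inclHom_boundary_sublevel` — **for `dim ≥ 3`,
  `π₁(∂{f ≤ a}) → π₁({f ≤ a})` is surjective** at every point of the level `f⁻¹(a) = ∂{f ≤ a}`
  (`IsMorseAdapted.surjective_and_injective_inclHom_boundary`).

## References

* J. Milnor, *Lectures on the h-cobordism theorem* (1965), Lemma 2.9, Thm. 3.14 and Remark.
  [MilnorHCobordism1965]
* A. Hatcher, *Algebraic Topology* (2002), Prop. 1.17, Prop. 1.26. [HatcherAT2002]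
-/

open scoped Manifold ContDiff Topology unitInterval
open Set Function Filter Metric
open Literature.AlgebraicTopology Literature.AlgebraicTopology.FundamentalGroup

noncomputable section

namespace Literature.Topology.FourManifolds

universe u

/-! ### Deformation retracts and connectedness -/

/-- **A space which strong deformation retracts onto a preconnected subset is preconnected.**
[cite: HatcherAT2002, Prop. 1.17] -/
theorem isPreconnected_univ_of_isStrongDeformationRetractOf {X : Type*} [TopologicalSpace X] {A : Set X}
    (hA : IsPreconnected A) (h : Homotopy.IsStrongDeformationRetractOf A (univ : Set X)) :
    IsPreconnected (univ : Set X) := by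
  obtain ⟨H, h0, h1, -⟩ := h
  rcases (univ : Set X).eq_empty_or_nonempty with he | ⟨x₀, -⟩
  · rw [he]; exact isPreconnected_empty
  set a : X := (H (1, ⟨x₀, mem_univ x₀⟩) : X) with ha
  have haA : a ∈ A := h1 _
  -- the track of a point joins it to a point of `A`
  have htrack : ∀ x : X, ∃ T : Set X, IsPreconnected T ∧ x ∈ T ∧ (H (1, ⟨x, mem_univ x⟩) : X) ∈ T := by
    intro x
    refine ⟨range fun t : I => (H (t, ⟨x, mem_univ x⟩) : X), isPreconnected_range ?_, ⟨0, by simp [h0]⟩, ⟨1, rfl⟩⟩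
    exact continuous_subtype_val.comp (H.continuous.comp (continuous_id.prodMk continuous_const))
  choose T hT using htrack
  have hcover : (univ : Set X) = ⋃₀ (range fun x : X => A ∪ T x) := by
    apply Subset.antisymm _ (subset_univ _)
    intro x _
    exact mem_sUnion.2 ⟨_, ⟨x, rfl⟩, Or.inr (hT x).2.1⟩
  rw [hcover]
  refine isPreconnected_sUnion a _ (fun S hS => ?_) (fun S hS => ?_)
  · obtain ⟨x, rfl⟩ := hS; exact Or.inl haA
  · obtain ⟨x, rfl⟩ := hS
    exact hA.union' ⟨_, h1 _, (hT x).2.2⟩ (hT x).1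

section Counts

variable {n : ℕ} {W : Type u} [TopologicalSpace W] [T2Space W] [SecondCountableTopology W]
  [CompactSpace W] [ChartedSpace (EuclideanHalfSpace (n + 1)) W] [IsManifold (𝓡∂ (n + 1)) ∞ W]

/-- **A `1`-handlebody with one `0`-handle is connected**: it strong deformation retracts onto a
ball with arcs attached at their end points, a preconnected set. [cite: MilnorHCobordism1965, Thm. 3.14 and Remark (PDF pp. 19–21)]
[cite: HatcherAT2002, Prop. 1.17] -/
theorem IsMorseAdapted.connectedSpace_of_counts {f : W → ℝ} (hf : IsMorseAdapted (𝓡∂ (n + 1)) f)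
    (h0 : (criticalSetOfIndex (𝓡∂ (n + 1)) f 0).ncard = 1)
    (h2 : ∀ k, 2 ≤ k → (criticalSetOfIndex (𝓡∂ (n + 1)) f k).ncard = 0) : ConnectedSpace W := by
  obtain ⟨β, P, _, E, _, _, Φ, -, -, hE, hΦβ, -, -, hsdr⟩ :=
    hf.exists_ball_union_arcs_isStrongDeformationRetractOf h0 rfl h2
  -- the ball with arcs is preconnected: every arc meets the ball
  haveI : PreconnectedSpace ↥(closedBall (0 : EuclideanSpace ℝ (Fin (n + 1))) 1) :=
    Subtype.preconnectedSpace (convex_closedBall _ _).isPreconnected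
  haveI : ∀ q, PreconnectedSpace ↥(closedBall (0 : E q) 1) := fun q =>
    Subtype.preconnectedSpace (convex_closedBall _ _).isPreconnected
  have hβc : IsPreconnected (range β) := isPreconnected_range β.continuous
  have harc : ∀ q, IsPreconnected (range β ∪ range (Φ q)) := fun q => by
    haveI : Nontrivial (E q) := Module.nontrivial_of_finrank_pos (R := ℝ) (by rw [hE q]; exact one_pos)
    obtain ⟨w, hw⟩ := exists_ne (0 : E q)
    set v : E q := ‖w‖⁻¹ • w with hv
    have hv1 : ‖v‖ = 1 := by rw [hv, norm_smul, norm_inv, norm_norm, inv_mul_cancel₀ (norm_ne_zero_iff.2 hw)]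
    have hmem : Φ q ⟨v, mem_closedBall_zero_iff.2 hv1.le⟩ ∈ range β := (hΦβ q ⟨v, _⟩).2 hv1
    exact IsPreconnected.union _ hmem (mem_range_self _) hβc (isPreconnected_range (Φ q).continuous)
  obtain ⟨b₀, hb₀⟩ : (range β).Nonempty := ⟨β ⟨0, by simp⟩, mem_range_self _⟩
  have hA : IsPreconnected (range β ∪ ⋃ q, range (Φ q)) := by
    have heq : ⋃₀ insert (range β) (range fun q => range β ∪ range (Φ q)) = range β ∪ ⋃ q, range (Φ q) := by
      rw [sUnion_insert, sUnion_range]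
      ext x
      simp only [mem_union, mem_iUnion]
      constructor
      · rintro (h | ⟨q, h | h⟩)
        · exact Or.inl h
        · exact Or.inl h
        · exact Or.inr ⟨q, h⟩
      · rintro (h | ⟨q, h⟩)
        · exact Or.inl h
        · exact Or.inr ⟨q, Or.inr h⟩
    rw [← heq]
    refine isPreconnected_sUnion b₀ _ (fun S hS => ?_) (fun S hS => ?_)
    · rcases hS with rfl | ⟨q, rfl⟩
      · exact hb₀
      · exact Or.inl hb₀
    · rcases hS with rfl | ⟨q, rfl⟩
      · exact hβc
      · exact harc q
  haveI : Nonempty W := ⟨b₀⟩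
  exact connectedSpace_iff_univ.2 ⟨univ_nonempty, isPreconnected_univ_of_isStrongDeformationRetractOf hA hsdr⟩

omit [T2Space W] [SecondCountableTopology W] in
/-- **The Morse data of a regular sublevel set of a `1`-handlebody** above its `0`-handle: with the
structure `sublevelAtlas` and the adapted Morse function `f| + (1 - a)` (`sublevel_morseData`),
`{f ≤ a}` has again exactly one critical point of index `0` and none of index `≥ 2`.
[cite: MilnorHCobordism1965, Lemma 2.9] -/
theorem IsMorseAdapted.sublevel_counts (hn : 1 ≤ n) {f : W → ℝ} (hf : IsMorseAdapted (𝓡∂ (n + 1)) f)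
    {a : ℝ} (ha : a < 1) (hreg : ∀ z, IsMCriticalPt (𝓡∂ (n + 1)) f z → f z ≠ a)
    (h0 : (criticalSetOfIndex (𝓡∂ (n + 1)) f 0).ncard = 1)
    (h2 : ∀ k, 2 ≤ k → (criticalSetOfIndex (𝓡∂ (n + 1)) f k).ncard = 0)
    (hmin : ∀ z ∈ criticalSetOfIndex (𝓡∂ (n + 1)) f 0, f z < a) :
    ∃ (hint : ∀ p, f p ≤ a → (𝓡∂ (n + 1)).IsInteriorPoint p)
      (hreg' : ∀ p, f p = a → ¬ IsMCriticalPt (𝓡∂ (n + 1)) f p),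
      letI := (sublevelAtlas hf.1.1 a hint hreg').chartedSpace
      IsManifold (𝓡∂ (n + 1)) ∞ ↥(f ⁻¹' Iic a) ∧
      IsMorseAdapted (𝓡∂ (n + 1)) (fun x : ↥(f ⁻¹' Iic a) => f x + (1 - a)) ∧
      (criticalSetOfIndex (𝓡∂ (n + 1)) (fun x : ↥(f ⁻¹' Iic a) => f x + (1 - a)) 0).ncard = 1 ∧
      (∀ k, 2 ≤ k → (criticalSetOfIndex (𝓡∂ (n + 1)) (fun x : ↥(f ⁻¹' Iic a) => f x + (1 - a)) k).ncard = 0) := by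
  obtain ⟨hint, hreg', hmfd, -, hF, hcrit, hidx⟩ := sublevel_morseData hn hf ha hreg
  refine ⟨hint, hreg', hmfd, hF, ?_, ?_⟩
  all_goals letI := (sublevelAtlas hf.1.1 a hint hreg').chartedSpace
  · -- index `0`: the same critical points
    have himg : Subtype.val '' criticalSetOfIndex (𝓡∂ (n + 1)) (fun x : ↥(f ⁻¹' Iic a) => f x + (1 - a)) 0 =
        criticalSetOfIndex (𝓡∂ (n + 1)) f 0 := by
      ext z
      simp only [mem_image, mem_criticalSetOfIndex]
      constructor
      · rintro ⟨x, ⟨hx, hx0⟩, rfl⟩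
        have hx' := (hcrit x).1 hx
        exact ⟨hx', by rw [← hidx x hx']; exact hx0⟩
      · rintro ⟨hz, hz0⟩
        have hza : f z ≤ a := (hmin z ⟨hz, hz0⟩).le
        refine ⟨⟨z, hza⟩, ⟨(hcrit ⟨z, hza⟩).2 hz, ?_⟩, rfl⟩
        rw [hidx ⟨z, hza⟩ hz]; exact hz0
    rw [← Set.ncard_image_of_injective _ Subtype.val_injective, himg]; exact h0
  · intro k hk
    have hfin : (criticalSetOfIndex (𝓡∂ (n + 1)) f k).Finite :=
      (IsMorse.finite_criticalSet_holds hf.1).subset (criticalSetOfIndex_subset _ f k)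
    have hempty : criticalSetOfIndex (𝓡∂ (n + 1)) f k = ∅ := (Set.ncard_eq_zero hfin).1 (h2 k hk)
    have hempty' : criticalSetOfIndex (𝓡∂ (n + 1)) (fun x : ↥(f ⁻¹' Iic a) => f x + (1 - a)) k = ∅ := by
      ext x
      simp only [mem_criticalSetOfIndex, mem_empty_iff_false, iff_false, not_and]
      intro hx hxk
      have hx' := (hcrit x).1 hx
      have : x.1 ∈ criticalSetOfIndex (𝓡∂ (n + 1)) f k := ⟨hx', by rw [← hidx x hx']; exact hxk⟩
      rw [hempty] at this
      exact this
    rw [hempty', Set.ncard_empty]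

/-- **A regular sublevel set of a `1`-handlebody above its `0`-handle is connected.** [cite: MilnorHCobordism1965, Lemma 2.9, Thm. 3.14 and Remark] -/
theorem IsMorseAdapted.connectedSpace_sublevel (hn : 1 ≤ n) {f : W → ℝ} (hf : IsMorseAdapted (𝓡∂ (n + 1)) f)
    {a : ℝ} (ha : a < 1) (hreg : ∀ z, IsMCriticalPt (𝓡∂ (n + 1)) f z → f z ≠ a)
    (h0 : (criticalSetOfIndex (𝓡∂ (n + 1)) f 0).ncard = 1)
    (h2 : ∀ k, 2 ≤ k → (criticalSetOfIndex (𝓡∂ (n + 1)) f k).ncard = 0)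
    (hmin : ∀ z ∈ criticalSetOfIndex (𝓡∂ (n + 1)) f 0, f z < a)
    (hint : ∀ p, f p ≤ a → (𝓡∂ (n + 1)).IsInteriorPoint p)
    (hreg' : ∀ p, f p = a → ¬ IsMCriticalPt (𝓡∂ (n + 1)) f p) :
    letI := (sublevelAtlas hf.1.1 a hint hreg').chartedSpace
    ConnectedSpace ↥(f ⁻¹' Iic a) := by
  obtain ⟨_, _, hmfd, hF, h0', h2'⟩ := hf.sublevel_counts hn ha hreg h0 h2 hmin
  letI := (sublevelAtlas hf.1.1 a hint hreg').chartedSpace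
  haveI := hmfd
  haveI : CompactSpace ↥(f ⁻¹' Iic a) := isCompact_iff_compactSpace.1 ((isClosed_Iic.preimage hf.1.1.continuous).isCompact)
  exact hF.connectedSpace_of_counts h0' h2'

/-- **`π₁` of the level maps onto `π₁` of the sublevel set** (`dim W = n + 1 ≥ 3`): for a regular
level `a < 1` above the `0`-handle of a `1`-handlebody with one `0`-handle, the map
`π₁(∂{f ≤ a}, w) → π₁({f ≤ a}, w)` induced by the inclusion of the boundary `f⁻¹(a)` is
surjective. [cite: MilnorHCobordism1965, Lemma 2.9, Thm. 3.14 and Remark] [cite: HatcherAT2002, Prop. 1.26] -/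
theorem IsMorseAdapted.surjective_inclHom_boundary_sublevel (hn : 2 ≤ n) {f : W → ℝ}
    (hf : IsMorseAdapted (𝓡∂ (n + 1)) f)
    {a : ℝ} (ha : a < 1) (hreg : ∀ z, IsMCriticalPt (𝓡∂ (n + 1)) f z → f z ≠ a)
    (h0 : (criticalSetOfIndex (𝓡∂ (n + 1)) f 0).ncard = 1)
    (h2 : ∀ k, 2 ≤ k → (criticalSetOfIndex (𝓡∂ (n + 1)) f k).ncard = 0)
    (hmin : ∀ z ∈ criticalSetOfIndex (𝓡∂ (n + 1)) f 0, f z < a)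
    (hint : ∀ p, f p ≤ a → (𝓡∂ (n + 1)).IsInteriorPoint p)
    (hreg' : ∀ p, f p = a → ¬ IsMCriticalPt (𝓡∂ (n + 1)) f p) :
    letI := (sublevelAtlas hf.1.1 a hint hreg').chartedSpace
    ∀ (w : ↥(f ⁻¹' Iic a)) (hw : w ∈ (𝓡∂ (n + 1)).boundary ↥(f ⁻¹' Iic a)),
      Function.Surjective (VanKampen.inclHom ((𝓡∂ (n + 1)).boundary ↥(f ⁻¹' Iic a)) w hw) := by
  obtain ⟨_, _, hmfd, hF, h0', h2'⟩ := hf.sublevel_counts (by omega) ha hreg h0 h2 hmin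
  letI := (sublevelAtlas hf.1.1 a hint hreg').chartedSpace
  haveI := hmfd
  haveI : CompactSpace ↥(f ⁻¹' Iic a) := isCompact_iff_compactSpace.1 ((isClosed_Iic.preimage hf.1.1.continuous).isCompact)
  haveI := hF.connectedSpace_of_counts h0' h2'
  intro w hw
  exact (hF.surjective_and_injective_inclHom_boundary h0' h2' hn hw).1

end Counts

end Literature.Topology.FourManifolds
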